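import Mathlib
import Literature.NumberTheory.LFunctions.Zhang2022.TypedSection10B
import Literature.NumberTheory.LFunctions.Zhang2022.TypedSection10C
import HarnessLib

/-!
# Zhang (2022) §10: truncation bridges between the `(d,r)`-sum objects and `𝔳₁ⱼ`, `𝔳₂ⱼ`

Topic `Literature/NumberTheory/LFunctions/Zhang2022` (Landau–Siegel audit tree; verdict-neutral).
Y. Zhang, *Discrete mean estimates and the Landau–Siegel zero*, arXiv:2211.02515v1 (2022)
[Zhang2022LandauSiegel] — **an unrefereed manuscript under adjudication**; this theorem-only TOOL
file (campaign siegel-zhang, L3-t8; no DAG node of its own) asserts nothing about Theorems 1–2.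

In the range evaluations of §10 (pp. 57–61: the sums over `dr` in `[P^a, P^b)` of
`S_j(𝐚₁₁,𝐚₁₃)`, `S_j(𝐚₁₃,𝐚₂₁)`, `S_j(𝐚₁₄,𝐚₂₂)`, `S_j(𝐚₁₂,𝐚₁₄)`) the manuscript plugs Lemma 10.1
(`𝔳₁ⱼ(y) = Σ_{m} χ(m)f̃(log(ym)/log P)m^{−(1−β_j)}`) and Lemma 10.2 (`𝔳₂ⱼ(d,r)`) — and their "simple
modifications" for the shifted tent `f̃(· + 0.004 − α̃)` (Remark p. 57) — into the inner `m`- and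
`n`-sums of `S_j`. In the tree the two sides are DIFFERENT finite sums: `Skeleton.Sj` (Prop. 7.1) and
hence L3-t2's inner sums `Typed.Sec10B.mSum13 / nSum13 / mSum14 / nSum14` truncate at
`Nsupp = ⌈PT⁻²⌉` (the support of the mollifier coefficients), while `Skeleton.frakv1 / frakv2` and
`Typed.Sec10B.frakv1S / frakv2S` sum over `m, n < ⌈P⌉`. This file proves that the two agree exactly
once `𝓛 = log D ≥ 3`, because every dropped index `k ≥ P/T²` satisfies `k ≥ P^{0.504}` (so
`f̃(log(·)/log P) = 0`, t2's `ftilde_log_eq_zero`) and `k ≥ P^{0.5}·Dt₀` (so the SHIFTED tent vanishes,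
`ftilde_shift_eq_zero`, via `log k/log P + 0.004 − α̃ = log(kP^{0.004}/(Dt₀))/log P`, t2's `shiftArg_eq`
of `Section10RemarkShift`, re-proved here privately to keep the import closure small):

* `mSum13_eq_frakv1`   : `mSum13 c′ χ j y = 𝔳₁ⱼ(y)` (`y ≥ 1`) — for Z22:§10.u043/u044, Small1321;
* `nSum13_eq_frakv2`   : `nSum13 c′ χ j d r = 𝔳₂ⱼ(d,r)` (`d, r ≥ 1`) — for Z22:§10.u036–u038;
* `mSum14_eq_frakv1S`  : `mSum14 c′ χ j y = frakv1S c′ χ j y` (`= 𝔳₁ⱼ(y*)`, `mSum14_eq_frakv1_yShift`,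
  with t2's `frakv1S_eq_frakv1`) — for Z22:§10.u049/u050;
* `nSum14_eq_frakv2S`  : `nSum14 c′ χ j d r = frakv2S c′ χ j d r` — for Z22:§10.u055–u057;
* the same two for L3-t8's `(d,r)`-indexed §10c objects (the ones `Typed.Sec10C.term1422 / term1214`
  are built from): `Typed.Sec10C.mSum14_eq_frakv1S / mSum14_eq_frakv1_yShift / nSum14_eq_frakv2S`;

plus the two size facts `rpow504_le_nsuppBound : P^{0.504} ≤ P/T²` and
`rpow50_mul_le_nsuppBound : P^{0.5}·(Dt₀) ≤ P/T²` (`𝓛 ≥ 3`; `P = e^{𝓛⁹}`, `T = e^{𝓛^{1.1}}`,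
`t₀ = 𝓛⁵¹⁹`, (2.6)). Nothing here uses (A) or `χ`'s properties.

## References

* Y. Zhang, arXiv:2211.02515v1 (2022), §10 pp. 57–61 (the four `S_j` evaluations), Lemma 10.1,
  Lemma 10.2, Remark p. 57; §2 (2.6), (2.28), (2.30). [cite: Zhang2022LandauSiegel, §10 pp. 57–61]
-/

noncomputable section

open Complex Real

namespace Literature.NumberTheory.LFunctions.Zhang2022.Typed.Sec10B

open Literature.NumberTheory.LFunctions.Zhang2022.Skeleton

/-! ### Sizes: `P/T² ≥ P^{0.504}` and `P/T² ≥ P^{0.5}·Dt₀` once `𝓛 ≥ 3` -/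

/-- `𝓛^{1.1} ≤ 𝓛²` for `𝓛 ≥ 1`. [folklore] -/
private theorem ell_rpow_le_sq {D : ℕ} (h1 : 1 ≤ ell D) : ell D ^ (1.1 : ℝ) ≤ ell D ^ 2 := by
  have h : ell D ^ (1.1 : ℝ) ≤ ell D ^ (2 : ℝ) :=
    Real.rpow_le_rpow_of_exponent_le h1 (by norm_num)
  simpa using h

/-- For `𝓛 ≥ 3`: `0.504·𝓛⁹ ≤ 𝓛⁹ − 2𝓛^{1.1}`, i.e. `P^{0.504} ≤ P/T²`. [cite: Zhang2022LandauSiegel, §2 (2.6)] -/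
theorem rpow504_le_nsuppBound {D : ℕ} (hℓ : 3 ≤ ell D) :
    bigP D ^ (0.504 : ℝ) ≤ bigP D / bigT D ^ 2 := by
  have h1 : 1 ≤ ell D := by linarith
  have hT : bigT D ^ 2 = Real.exp (2 * ell D ^ (1.1 : ℝ)) := by
    rw [bigT, ← Real.exp_nat_mul]; norm_num
  rw [hT, bigP, ← Real.exp_mul, ← Real.exp_sub, Real.exp_le_exp]
  have h11 := ell_rpow_le_sq h1
  have h7 : (3 : ℝ) ^ 7 ≤ ell D ^ 7 := pow_le_pow_left₀ (by norm_num) hℓ 7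
  nlinarith [pow_nonneg (by linarith : (0 : ℝ) ≤ ell D) 2]

/-- For `𝓛 ≥ 3`: `P^{0.5}·(Dt₀) ≤ P/T²` (`D = e^{𝓛}`, `t₀ = 𝓛⁵¹⁹ ≤ e^{519𝓛}`, `T² = e^{2𝓛^{1.1}}`).
[cite: Zhang2022LandauSiegel, §2 (2.6)] -/
theorem rpow50_mul_le_nsuppBound {D : ℕ} (hℓ : 3 ≤ ell D) :
    bigP D ^ (0.5 : ℝ) * ((D : ℝ) * t0 D) ≤ bigP D / bigT D ^ 2 := by
  have h1 : 1 ≤ ell D := by linarith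
  have h0 : 0 ≤ ell D := by linarith
  have hD0 : (0 : ℝ) < D := by
    have : 0 < ell D := by linarith
    rw [ell] at this
    by_contra h
    have hD : (D : ℝ) = 0 := le_antisymm (not_lt.mp h) (Nat.cast_nonneg D)
    rw [hD, Real.log_zero] at this
    exact lt_irrefl _ this
  have hDexp : (D : ℝ) = Real.exp (ell D) := by rw [ell, Real.exp_log hD0]
  have ht0 : t0 D ≤ Real.exp (519 * ell D) := by
    rw [t0, show (519 : ℝ) * ell D = ((519 : ℕ) : ℝ) * ell D by norm_num, Real.exp_nat_mul]
    refine pow_le_pow_left₀ h0 ?_ 519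
    have := Real.add_one_le_exp (ell D); linarith
  have hT : bigT D ^ 2 = Real.exp (2 * ell D ^ (1.1 : ℝ)) := by
    rw [bigT, ← Real.exp_nat_mul]; norm_num
  have hTpos : 0 < bigT D ^ 2 := by rw [hT]; exact Real.exp_pos _
  rw [le_div_iff₀ hTpos, hT, bigP, ← Real.exp_mul, hDexp]
  have ht0' : 0 ≤ t0 D := by rw [t0]; exact pow_nonneg h0 _
  calc Real.exp (ell D ^ 9 * 0.5) * (Real.exp (ell D) * t0 D) * Real.exp (2 * ell D ^ (1.1 : ℝ))
      ≤ Real.exp (ell D ^ 9 * 0.5) * (Real.exp (ell D) * Real.exp (519 * ell D)) *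
          Real.exp (2 * ell D ^ (1.1 : ℝ)) := by gcongr
    _ = Real.exp (ell D ^ 9 * 0.5 + ell D + 519 * ell D + 2 * ell D ^ (1.1 : ℝ)) := by
          simp only [← Real.exp_add]; ring_nf
    _ ≤ Real.exp (ell D ^ 9) := by
          rw [Real.exp_le_exp]
          have h11 := ell_rpow_le_sq h1
          have h7 : (3 : ℝ) ^ 7 ≤ ell D ^ 7 := pow_le_pow_left₀ (by norm_num) hℓ 7
          nlinarith [pow_nonneg h0 2]

/-- The index ranges: `[1, Nsupp) ⊆ [1, ⌈P⌉)` since `Nsupp = ⌈P/T²⌉ ≤ ⌈P⌉` (the latter inequality is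
d56's `Sec18SjNorm.Nsupp_le_ceil_bigP` of `Section18RangeTools`; re-derived inline to keep this file's
imports inside §10). [cite: Zhang2022LandauSiegel, §7 p. 44] -/
private theorem Ico_nsupp_subset (D : ℕ) : Finset.Ico 1 (Nsupp D) ⊆ Finset.Ico 1 ⌈bigP D⌉₊ := by
  refine Finset.Ico_subset_Ico_right ?_
  rw [Nsupp]
  refine Nat.ceil_mono ?_
  have hP : 0 ≤ bigP D := (Real.exp_pos _).le
  have hT1 : 1 ≤ bigT D ^ 2 := one_le_pow₀ (Real.one_le_exp (Real.rpow_nonneg (by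
    rw [ell]; exact Real.log_natCast_nonneg D) _))
  exact div_le_self hP hT1

/-- A term index beyond the truncation `Nsupp` is `≥ P/T²`. [folklore] -/
private theorem nsuppBound_le_of_le {D n : ℕ} (hn : Nsupp D ≤ n) : bigP D / bigT D ^ 2 ≤ n :=
  (Nat.le_ceil _).trans (by exact_mod_cast hn)

/-! ### The four truncation identities -/

/-- **`mSum13 = 𝔳₁ⱼ`**: for `𝓛 ≥ 3` and every `y ≥ 1`, the `m`-sum of `S_j(𝐚₁₃,𝐚₂₁)` truncated at
`⌈PT⁻²⌉` (t2's `mSum13`) equals `Skeleton.frakv1` (Lemma 10.1's `𝔳₁ⱼ(y)`, `m < ⌈P⌉`): the extra terms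
have `ym ≥ P/T² ≥ P^{0.504}`, where `f̃ = 0`. [cite: Zhang2022LandauSiegel, §10 p. 58] -/
theorem mSum13_eq_frakv1 (c' : ℝ) {D : ℕ} (χ : DirichletCharacter ℂ D) (hℓ : 3 ≤ ell D) (j : ℕ)
    {y : ℕ} (hy : 1 ≤ y) : mSum13 c' χ j y = frakv1 c' χ j (y : ℝ) := by
  unfold mSum13 frakv1
  rw [← Finset.sum_subset (Ico_nsupp_subset D)]
  · refine Finset.sum_congr rfl fun m _ => ?_
    push_cast; rfl
  · intro m hm hm'
    rw [Finset.mem_Ico] at hm hm'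
    have hmN : Nsupp D ≤ m := by
      by_contra h; exact hm' ⟨hm.1, not_le.mp h⟩
    have hk : bigP D ^ (0.504 : ℝ) ≤ ((y * m : ℕ) : ℝ) := by
      refine (rpow504_le_nsuppBound hℓ).trans ((nsuppBound_le_of_le hmN).trans ?_)
      exact_mod_cast Nat.le_mul_of_pos_left _ hy
    have : ftilde (Real.log ((y : ℝ) * m) / Real.log (bigP D)) = 0 := by
      have h := ftilde_log_eq_zero hk
      push_cast at h
      exact h
    rw [this]; simp

/-- **`nSum13 = 𝔳₂ⱼ`**: for `𝓛 ≥ 3` and all `d, r`, t2's `nSum13` (`n < ⌈PT⁻²⌉`) equals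
`Skeleton.frakv2` (Lemma 10.2's `𝔳₂ⱼ(d,r)`, `n < ⌈P⌉`): the extra terms have `drn ≥ n ≥ P/T² ≥ P^{0.504}`.
[cite: Zhang2022LandauSiegel, §10 p. 57] -/
theorem nSum13_eq_frakv2 (c' : ℝ) {D : ℕ} (χ : DirichletCharacter ℂ D) (hℓ : 3 ≤ ell D) (j : ℕ)
    {d r : ℕ} (hd : 1 ≤ d) (hr : 1 ≤ r) : nSum13 c' χ j d r = frakv2 c' χ j d r := by
  unfold nSum13 frakv2
  rw [← Finset.sum_subset (Ico_nsupp_subset D)]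
  intro n hn hn'
  rw [Finset.mem_Ico] at hn hn'
  have hnN : Nsupp D ≤ n := by
    by_contra h; exact hn' ⟨hn.1, not_le.mp h⟩
  have hk : bigP D ^ (0.504 : ℝ) ≤ ((d * r * n : ℕ) : ℝ) := by
    refine (rpow504_le_nsuppBound hℓ).trans ((nsuppBound_le_of_le hnN).trans ?_)
    exact_mod_cast Nat.le_mul_of_pos_left _ (Nat.mul_pos hd hr)
  rw [ftilde_log_eq_zero hk]; simp

/-- `log y/log P + 0.004 − α̃ = log(y*)/log P`, `y* = yP^{0.004}/(Dt₀)` (`D ≥ 2`, `y > 0`) — the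
statement of L3-t2's `Typed.Sec10B.shiftArg_eq` (`Section10RemarkShift`), re-proved to avoid importing
`TypedSection10A`. [cite: Zhang2022LandauSiegel, §10 p. 57] -/
private theorem shiftArg_eq' {D : ℕ} (hD : 2 ≤ D) {y : ℝ} (hy : 0 < y) :
    Real.log y / Real.log (bigP D) + 0.004 - alphaTilde D =
      Real.log (yShift D y) / Real.log (bigP D) := by
  have hD1 : (1 : ℝ) < D := by exact_mod_cast hD
  have hell : 0 < ell D := Real.log_pos hD1
  have hP : 0 < bigP D := Real.exp_pos _
  have hlogP : Real.log (bigP D) ≠ 0 := by rw [bigP, Real.log_exp]; positivity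
  have ht0 : 0 < t0 D := by rw [t0]; positivity
  have hDt : 0 < (D : ℝ) * t0 D := by positivity
  have hpow : 0 < bigP D ^ (0.004 : ℝ) := Real.rpow_pos_of_pos hP _
  rw [yShift, alphaTilde, Real.log_div (by positivity) hDt.ne', Real.log_mul hy.ne' hpow.ne',
    Real.log_rpow hP]
  field_simp

/-- The shifted tent vanishes beyond `P^{0.5}·Dt₀`: `f̃(log k/log P + 0.004 − α̃) = 0` for
`k ≥ P^{0.5}Dt₀` (`D ≥ 2`). [cite: Zhang2022LandauSiegel, §10 p. 57] -/
theorem ftilde_shift_eq_zero {D : ℕ} (hD : 2 ≤ D) {k : ℝ}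
    (hk : bigP D ^ (0.5 : ℝ) * ((D : ℝ) * t0 D) ≤ k) :
    ftilde (Real.log k / Real.log (bigP D) + 0.004 - alphaTilde D) = 0 := by
  have hD1 : (1 : ℝ) < D := by exact_mod_cast hD
  have ht0 : 0 < t0 D := by rw [t0]; exact pow_pos (Real.log_pos hD1) _
  have hDt : 0 < (D : ℝ) * t0 D := by positivity
  have hP : 0 < bigP D := Real.exp_pos _
  have hP1 : 1 < bigP D := by
    rw [bigP]; exact Real.one_lt_exp_iff.2 (pow_pos (Real.log_pos hD1) 9)
  have hk0 : 0 < k := lt_of_lt_of_le (by positivity) hk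
  rw [shiftArg_eq' hD hk0]
  apply Lemma101.ftilde_eq_zero_of_ge
  rw [le_div_iff₀ (Real.log_pos hP1), ← Real.log_rpow hP]
  refine Real.log_le_log (Real.rpow_pos_of_pos hP _) ?_
  rw [yShift, le_div_iff₀ hDt]
  have h504 : bigP D ^ (0.504 : ℝ) = bigP D ^ (0.5 : ℝ) * bigP D ^ (0.004 : ℝ) := by
    rw [← Real.rpow_add hP]; norm_num
  rw [h504]
  calc bigP D ^ (0.5 : ℝ) * bigP D ^ (0.004 : ℝ) * ((D : ℝ) * t0 D)
      = bigP D ^ (0.5 : ℝ) * ((D : ℝ) * t0 D) * bigP D ^ (0.004 : ℝ) := by ring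
    _ ≤ k * bigP D ^ (0.004 : ℝ) := by gcongr

/-- `𝓛 ≥ 3 ⇒ D ≥ 2`. [folklore] -/
private theorem two_le_of_ell {D : ℕ} (hℓ : 3 ≤ ell D) : 2 ≤ D := by
  by_contra h
  have h2 : D < 2 := not_le.mp h
  interval_cases D
  · simp [ell] at hℓ; linarith
  · simp [ell] at hℓ; linarith

/-- **`mSum14 = shifted 𝔳₁ⱼ`**: for `𝓛 ≥ 3` and every `y ≥ 1`, t2's `mSum14` (the `m`-sum of
`S_j(𝐚₁₄,𝐚₂₂)`, `m < ⌈PT⁻²⌉`) equals `frakv1S` (`m < ⌈P⌉`): the extra terms have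
`ym ≥ P/T² ≥ P^{0.5}Dt₀`, where the shifted `f̃` vanishes. With t2's `frakv1S_eq_frakv1` this is
`𝔳₁ⱼ(y*)`, `y* = yP^{0.004}/(Dt₀)`. [cite: Zhang2022LandauSiegel, §10 p. 59] -/
theorem mSum14_eq_frakv1S (c' : ℝ) {D : ℕ} (χ : DirichletCharacter ℂ D) (hℓ : 3 ≤ ell D) (j : ℕ)
    {y : ℕ} (hy : 1 ≤ y) : mSum14 c' χ j y = frakv1S c' χ j (y : ℝ) := by
  unfold mSum14 frakv1S
  rw [← Finset.sum_subset (Ico_nsupp_subset D)]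
  · refine Finset.sum_congr rfl fun m _ => ?_
    push_cast; rfl
  · intro m hm hm'
    rw [Finset.mem_Ico] at hm hm'
    have hmN : Nsupp D ≤ m := by
      by_contra h; exact hm' ⟨hm.1, not_le.mp h⟩
    have hk : bigP D ^ (0.5 : ℝ) * ((D : ℝ) * t0 D) ≤ ((y * m : ℕ) : ℝ) := by
      refine (rpow50_mul_le_nsuppBound hℓ).trans ((nsuppBound_le_of_le hmN).trans ?_)
      exact_mod_cast Nat.le_mul_of_pos_left _ hy
    have : ftilde (Real.log ((y : ℝ) * m) / Real.log (bigP D) + 0.004 - alphaTilde D) = 0 := by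
      have h := ftilde_shift_eq_zero (two_le_of_ell hℓ) hk
      push_cast at h
      exact h
    rw [this]; simp

/-- `mSum14 (y) = 𝔳₁ⱼ(y*)` (the previous identity composed with t2's `frakv1S_eq_frakv1`).
[cite: Zhang2022LandauSiegel, §10 p. 59] -/
theorem mSum14_eq_frakv1_yShift (c' : ℝ) {D : ℕ} (χ : DirichletCharacter ℂ D) (hℓ : 3 ≤ ell D)
    (j : ℕ) {y : ℕ} (hy : 1 ≤ y) : mSum14 c' χ j y = frakv1 c' χ j (yShift D y) := by
  rw [mSum14_eq_frakv1S c' χ hℓ j hy,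
    frakv1S_eq_frakv1 c' χ (two_le_of_ell hℓ) j (by exact_mod_cast hy)]

/-- **`nSum14 = shifted 𝔳₂ⱼ`**: for `𝓛 ≥ 3` and all `d, r ≥ 1`, t2's `nSum14` (`n < ⌈PT⁻²⌉`) equals
`frakv2S` (`n < ⌈P⌉`). [cite: Zhang2022LandauSiegel, §10 p. 60] -/
theorem nSum14_eq_frakv2S (c' : ℝ) {D : ℕ} (χ : DirichletCharacter ℂ D) (hℓ : 3 ≤ ell D) (j : ℕ)
    {d r : ℕ} (hd : 1 ≤ d) (hr : 1 ≤ r) : nSum14 c' χ j d r = frakv2S c' χ j d r := by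
  unfold nSum14 frakv2S
  rw [← Finset.sum_subset (Ico_nsupp_subset D)]
  intro n hn hn'
  rw [Finset.mem_Ico] at hn hn'
  have hnN : Nsupp D ≤ n := by
    by_contra h; exact hn' ⟨hn.1, not_le.mp h⟩
  have hk : bigP D ^ (0.5 : ℝ) * ((D : ℝ) * t0 D) ≤ ((d * r * n : ℕ) : ℝ) := by
    refine (rpow50_mul_le_nsuppBound hℓ).trans ((nsuppBound_le_of_le hnN).trans ?_)
    exact_mod_cast Nat.le_mul_of_pos_left _ (Nat.mul_pos hd hr)
  rw [ftilde_shift_eq_zero (two_le_of_ell hℓ) hk]; simp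

end Literature.NumberTheory.LFunctions.Zhang2022.Typed.Sec10B

namespace Literature.NumberTheory.LFunctions.Zhang2022.Typed.Sec10C

open Literature.NumberTheory.LFunctions.Zhang2022.Skeleton
open Literature.NumberTheory.LFunctions.Zhang2022.Typed.Sec10B

/-- `𝓛 ≥ 3 ⇒ D ≥ 2`. [folklore] -/
private theorem two_le_of_ell' {D : ℕ} (hℓ : 3 ≤ ell D) : 2 ≤ D := by
  by_contra h
  have h2 : D < 2 := not_le.mp h
  interval_cases D
  · simp [ell] at hℓ; linarith
  · simp [ell] at hℓ; linarith

/-- **§10c form: `Sec10C.mSum14 c′ χ j d r = frakv1S c′ χ j (dr)`** (`𝓛 ≥ 3`, `d, r ≥ 1`): the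
`(d,r)`-indexed `m`-sum of `S_j(𝐚₁₄,𝐚₂₂)` in `TypedSection10C` (truncated at `⌈PT⁻²⌉`) is the shifted
`𝔳₁ⱼ`-sum of L3-t2 at `y = dr`. [cite: Zhang2022LandauSiegel, §10 p. 59] -/
theorem mSum14_eq_frakv1S (c' : ℝ) {D : ℕ} (χ : DirichletCharacter ℂ D) (hℓ : 3 ≤ ell D) (j : ℕ)
    {d r : ℕ} (hd : 1 ≤ d) (hr : 1 ≤ r) :
    Sec10C.mSum14 c' χ j d r = frakv1S c' χ j ((d * r : ℕ) : ℝ) := by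
  rw [← Sec10B.mSum14_eq_frakv1S c' χ hℓ j (Nat.mul_pos hd hr)]
  unfold Sec10C.mSum14 Sec10B.mSum14
  rfl

/-- `Sec10C.mSum14 c′ χ j d r = 𝔳₁ⱼ(y*)`, `y* = drP^{0.004}/(Dt₀)`. [cite: Zhang2022LandauSiegel, §10 p. 59] -/
theorem mSum14_eq_frakv1_yShift (c' : ℝ) {D : ℕ} (χ : DirichletCharacter ℂ D) (hℓ : 3 ≤ ell D)
    (j : ℕ) {d r : ℕ} (hd : 1 ≤ d) (hr : 1 ≤ r) :
    Sec10C.mSum14 c' χ j d r = frakv1 c' χ j (yShift D ((d * r : ℕ) : ℝ)) := by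
  rw [mSum14_eq_frakv1S c' χ hℓ j hd hr, frakv1S_eq_frakv1 c' χ (two_le_of_ell' hℓ) j
    (by exact_mod_cast Nat.mul_pos hd hr)]

/-- **§10c form: `Sec10C.nSum14 c′ χ j d r = frakv2S c′ χ j d r`** (`𝓛 ≥ 3`, `d, r ≥ 1`).
[cite: Zhang2022LandauSiegel, §10 p. 60] -/
theorem nSum14_eq_frakv2S (c' : ℝ) {D : ℕ} (χ : DirichletCharacter ℂ D) (hℓ : 3 ≤ ell D) (j : ℕ)
    {d r : ℕ} (hd : 1 ≤ d) (hr : 1 ≤ r) : Sec10C.nSum14 c' χ j d r = frakv2S c' χ j d r := by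
  rw [← Sec10B.nSum14_eq_frakv2S c' χ hℓ j hd hr]
  unfold Sec10C.nSum14 Sec10B.nSum14
  rfl

end Literature.NumberTheory.LFunctions.Zhang2022.Typed.Sec10C
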